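import Summits.QuantumFields.YangMills.Theorems.UnitScaleTiltProp8FlatActionGradient
import Summits.QuantumFields.YangMills.Theorems.UnitScaleTiltProp8FlatCriticalOfMinimum
import HarnessLib

/-!
# Route `UnitScaleTilt`, crux K1 child «MinimiserStabilityRegPr» (stmt-QuantumFields-19200), registered stub V2′ `stub_halvingStep` (v8 5b4e846794b80374 ∕ v10
# `BirthV10`) — pillar P5 at background 1: **THE EULER–LAGRANGE CONDITION OF THE WILSON ACTION IN THE FLAT EXPONENTIAL CHART, IN TRACE CURRENCY, BASIS-FREE** —
# if a bond field `A` minimises `Re 𝒮_η` (= `wilsonAction4` in the chart, `FlatActionGradient.wilsonAction4_eq_re_action`) over the affine-constraint ball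
# `{X | Q X = Q A} ∩ B(A, ρ)` of ANY real-linear constraint `Q` (print's `L^jηQ_jA′ = B`, (157)), or over any set containing the segments `A + tδ`, then for every
# direction `δ ∈ ker Q`: `Re[(η²/2)·Σ_p tr(Φ_p(A)Φ_p(δ)) + η⁴·Σ_b tr(W₀(A)(b)δ(b))] = 0` — print's (99)∕(127) `⟨δA′, Δ₁A′⟩ + ⟨δA′, (δ/δA′)V(A′)⟩ = 0` for
# `QδA′ = 0` at `J = 0`, the input that w3's `FlatCriticalOfMin.hcrit_of_isMinOn_affineBall` ∕ F4's `FlatCriticalEquation143.eq143_of_critical` read in real coordinates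

Cell `ym3-torus` (HUMAN RULING D-0037, YM ladder rung R3 — continuum SU(2) YM₃ on the torus is a RUNG, not the Clay problem), width seat `ym-ust-19200-w5` gen 2
(P3b lineage; sequel of ✓ p598803 `FlatActionGradient`).  `--supports stmt-QuantumFields-19200 --as helper`; def-free, 0 sorry, standard axioms.  First-order calculus
over the REAL structure of the complex normed space of `M₂(ℂ)`-valued bond fields (`HasFDerivAt.restrictScalars`, `Complex.reCLM`) and w3's generic
`FlatCriticalOfMin.fderiv_apply_eq_zero_of_isMinOn_segment`; no coordinates are chosen (the passage to F4's `ι → ℝ` dot-product letters is the assembler's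
`tr`-pairing ↔ inner-product dictionary, one line per basis).

THE PRINT ([Balaban1985Variational], CMP **102** (1985) 277–309; journal page = PDF page + 276).  p. 293 (99)–(100): *«⟨δA′, J⟩ + ⟨δA′, Δ₁A′⟩ + ⟨δA′, (δ/δA′)V(A′)⟩
= 0. (99) This equation has to be satisfied for all δA′ satisfying QδA′ = 0 …»*; p. 297 (127); p. 302 (157)–(158): *«The image of U′_k is a minimum of 𝔊(A′), thus
representing it as A₁ + HB, we obtain Eq. (143) for A₁»*.

WHAT THIS FILE PROVES (every `Params` `P`, level `j`):
* §1 (generic, any complex normed space `E`) **`re_fderiv_eq_zero_of_isMinOn_segment`** — if `g : E → ℂ` is ℂ-differentiable at `x` and `Re ∘ g` is minimal at `x` over a set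
  containing the real segment `{x + tδ : |t| < r}`, then `Re (Dg(x)[δ]) = 0`; `segment_subset_affineBall_linear` — for an ℝ-linear `Q` with `Qδ = 0`, the segment
  `|t| < ρ/(‖δ‖ + 1)` stays in `{X | QX = Qx} ∩ B(x, ρ)` (and in any real submodule containing `x`, `δ`: `segment_subset_affineBall_submodule`).
* §2 **`re_gradient_pairing_eq_zero_of_isMinOn`** — for `0 < η`, any `W` with the gradient identity of `FlatActionGradient.exists_gradient_action` (`𝒮_η` differentiable,
  `D𝒮_η(A)[δ] = (η²/2)Σ_p tr(Φ_p(A)Φ_p(δ)) + η⁴Σ_b tr(W(A)(b)δ(b))`), a minimiser `A` of `Re 𝒮_η` over a set containing the segments through `A` in direction `δ` has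
  `Re[(η²/2)Σ_p tr(Φ_p(A)Φ_p(δ)) + η⁴Σ_b tr(W(A)(b)δ(b))] = 0`; **`re_gradient_pairing_eq_zero_of_isMinOn_affineBall`** — the same for the affine-constraint ball of an
  ℝ-linear `Q` within a real submodule `V` (e.g. the Hermitian, or Hermitian traceless, fields) and every `δ ∈ V ∩ ker Q`.
* §3 **`re_gradient_pairing_eq_zero_of_isMinOn_wilson`** — the same with the hypothesis stated on the tree's `wilsonAction4 ∘ U` for any chart `U` with `↑(U X)(b) = e^{iηX(b)}`
  on the (bondwise self-adjoint) competitor set (`wilsonAction4_eq_re_action`).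
HONEST SCOPE: the chart dressing `A′ ↦ A′ − HD(A′)` (compose with `FlatProp4Dressing.differentiableOn_chartShift` by the chain rule), the identification of the route's
fibre `regFibrePr` with an affine-constraint ball in the chart ((156)–(157), pillar P1 + C_k), and the coordinates for F4's matrix letters are NOT done here.  NOT a claim
about the stub, the crux, the rung or the gap.

References: T. Bałaban, CMP **102** (1985) 277–309 [Balaban1985Variational] (99)–(100) p.293, (127) p.297, (157)–(158) p.302.
-/

set_option autoImplicit false

noncomputable section

open scoped BigOperators Matrix.Norms.L2Operator
open NormedSpace Finset

namespace Summit.QuantumFields.YangMills.Theorems.FlatActionCritical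

open Literature.MathematicalPhysics.QuantumFieldTheory.Balaban1983to89
open Summit.QuantumFields.YangMills.Theorems.FlatCriticalOfMin (fderiv_apply_eq_zero_of_isMinOn_segment)
open Summit.QuantumFields.YangMills.Theorems.FlatActionGradient (wilsonAction4_eq_re_action)

/-! ## §1 Real directional derivatives of real parts of holomorphic functions; segments in affine-constraint balls -/

section Generic

variable {E : Type*} [NormedAddCommGroup E] [NormedSpace ℂ E]

/-- **MINIMUM OF `Re g` ⇒ `Re (Dg(x)[δ]) = 0` ALONG EVERY SEGMENT INSIDE THE COMPETITOR SET** (`g` holomorphic at `x`; the real derivative of `Re ∘ g` is `Re ∘ Dg(x)`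
restricted to real scalars). [cite: Balaban1985Variational, (127) p.297, (99) p.293] -/
theorem re_fderiv_eq_zero_of_isMinOn_segment {g : E → ℂ} {x δ : E} (hg : DifferentiableAt ℂ g x) {T : Set E} {r : ℝ} (hr : 0 < r)
    (hT : ∀ t : ℝ, |t| < r → x + t • δ ∈ T) (hmin : IsMinOn (fun X => (g X).re) T x) :
    (fderiv ℂ g x δ).re = 0 := by
  have h1 : HasFDerivAt g ((fderiv ℂ g x).restrictScalars ℝ) x := hg.hasFDerivAt.restrictScalars ℝ
  have h2 : HasFDerivAt (fun X => (g X).re) (Complex.reCLM.comp ((fderiv ℂ g x).restrictScalars ℝ)) x :=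
    Complex.reCLM.hasFDerivAt.comp x h1
  have h := fderiv_apply_eq_zero_of_isMinOn_segment hr h2 hT hmin
  simpa using h

/-- For an ℝ-linear constraint `Q` with `Qδ = 0`, the segment `|t| < ρ/(‖δ‖ + 1)` through `x` stays in `{X | QX = Qx} ∩ B(x, ρ)` (the linear-map twin of w3's
`FlatCriticalOfMin.segment_subset_affineBall`). [cite: Balaban1985Variational, (157) p.302] -/
theorem segment_subset_affineBall_linear {F : Type*} [AddCommGroup F] [Module ℝ F] (Q : E →ₗ[ℝ] F) (x δ : E) (hδ : Q δ = 0) (ρ : ℝ) :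
    ∀ t : ℝ, |t| < ρ / (‖δ‖ + 1) → x + t • δ ∈ {X : E | Q X = Q x ∧ dist X x < ρ} := by
  intro t ht
  have hn : 0 < ‖δ‖ + 1 := by positivity
  refine ⟨by rw [map_add, map_smul, hδ, smul_zero, add_zero], ?_⟩
  rw [dist_eq_norm, add_sub_cancel_left, norm_smul, Real.norm_eq_abs]
  have h1 : |t| * ‖δ‖ ≤ |t| * (‖δ‖ + 1) := mul_le_mul_of_nonneg_left (by linarith) (abs_nonneg t)
  have h2 : |t| * (‖δ‖ + 1) < ρ := by rwa [lt_div_iff₀ hn] at ht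
  linarith

/-- The same inside a real submodule `V ∋ x, δ` (e.g. the bondwise Hermitian, or Hermitian traceless, fields). [cite: Balaban1985Variational, (157) p.302] -/
theorem segment_subset_affineBall_submodule {F : Type*} [AddCommGroup F] [Module ℝ F] (Q : E →ₗ[ℝ] F) (V : Submodule ℝ E) (x δ : E)
    (hx : x ∈ V) (hδV : δ ∈ V) (hδ : Q δ = 0) (ρ : ℝ) :
    ∀ t : ℝ, |t| < ρ / (‖δ‖ + 1) → x + t • δ ∈ {X : E | X ∈ V ∧ Q X = Q x ∧ dist X x < ρ} := by
  intro t ht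
  obtain ⟨h1, h2⟩ := segment_subset_affineBall_linear Q x δ hδ ρ t ht
  exact ⟨V.add_mem hx (V.smul_mem t hδV), h1, h2⟩

end Generic

/-! ## §2 The Euler–Lagrange condition of `Re 𝒮_η` in trace currency -/

section Action

variable {P : Params} {j : ℕ} (η : ℝ)

/-- **`Re[(η²/2)Σ_p tr(Φ_p(A)Φ_p(δ)) + η⁴Σ_b tr(W(A)(b)δ(b))] = 0` AT A CONSTRAINED MINIMISER OF `Re 𝒮_η`** — for any `W` with the gradient identity of
`FlatActionGradient.exists_gradient_action` and any competitor set containing the segments through `A` in direction `δ`: print's (99) *«⟨δA′, Δ₁A′⟩ +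
⟨δA′, (δ/δA′)V(A′)⟩ = 0»* at `J = 0`, pairing written as `tr`. [cite: Balaban1985Variational, (99)-(100) p.293, (127) p.297, (158) p.302] -/
theorem re_gradient_pairing_eq_zero_of_isMinOn (W : (PBond P j → Matrix (Fin 2) (Fin 2) ℂ) → (PBond P j → Matrix (Fin 2) (Fin 2) ℂ))
    (hSd : Differentiable ℂ (fun A : PBond P j → Matrix (Fin 2) (Fin 2) ℂ => (∑ p : Plaq P j, (1 - (2 : ℂ)⁻¹ * Matrix.trace (exp ((Complex.I * (η : ℂ)) • A ⟨p.src, p.μ⟩) * exp ((Complex.I * (η : ℂ)) • A ⟨p.src.shift p.μ, p.ν⟩) * exp (-((Complex.I * (η : ℂ)) • A ⟨p.src.shift p.ν, p.μ⟩)) * exp (-((Complex.I * (η : ℂ)) • A ⟨p.src, p.ν⟩)))))))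
    (hgrad : ∀ A δ : PBond P j → Matrix (Fin 2) (Fin 2) ℂ, fderiv ℂ (fun A : PBond P j → Matrix (Fin 2) (Fin 2) ℂ => (∑ p : Plaq P j, (1 - (2 : ℂ)⁻¹ * Matrix.trace (exp ((Complex.I * (η : ℂ)) • A ⟨p.src, p.μ⟩) * exp ((Complex.I * (η : ℂ)) • A ⟨p.src.shift p.μ, p.ν⟩) * exp (-((Complex.I * (η : ℂ)) • A ⟨p.src.shift p.ν, p.μ⟩)) * exp (-((Complex.I * (η : ℂ)) • A ⟨p.src, p.ν⟩)))))) A δ =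
      ((η : ℂ) ^ 2 / 2) * ∑ p : Plaq P j, Matrix.trace ((A ⟨p.src, p.μ⟩ + A ⟨p.src.shift p.μ, p.ν⟩ - A ⟨p.src.shift p.ν, p.μ⟩ - A ⟨p.src, p.ν⟩) * (δ ⟨p.src, p.μ⟩ + δ ⟨p.src.shift p.μ, p.ν⟩ - δ ⟨p.src.shift p.ν, p.μ⟩ - δ ⟨p.src, p.ν⟩)) + (η : ℂ) ^ 4 * ∑ b : PBond P j, Matrix.trace (W A b * δ b))
    {A δ : PBond P j → Matrix (Fin 2) (Fin 2) ℂ} {T : Set (PBond P j → Matrix (Fin 2) (Fin 2) ℂ)} {r : ℝ} (hr : 0 < r)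
    (hT : ∀ t : ℝ, |t| < r → A + t • δ ∈ T) (hmin : IsMinOn (fun X => ((fun A : PBond P j → Matrix (Fin 2) (Fin 2) ℂ => (∑ p : Plaq P j, (1 - (2 : ℂ)⁻¹ * Matrix.trace (exp ((Complex.I * (η : ℂ)) • A ⟨p.src, p.μ⟩) * exp ((Complex.I * (η : ℂ)) • A ⟨p.src.shift p.μ, p.ν⟩) * exp (-((Complex.I * (η : ℂ)) • A ⟨p.src.shift p.ν, p.μ⟩)) * exp (-((Complex.I * (η : ℂ)) • A ⟨p.src, p.ν⟩)))))) X).re) T A) :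
    (((η : ℂ) ^ 2 / 2) * ∑ p : Plaq P j, Matrix.trace ((A ⟨p.src, p.μ⟩ + A ⟨p.src.shift p.μ, p.ν⟩ - A ⟨p.src.shift p.ν, p.μ⟩ - A ⟨p.src, p.ν⟩) * (δ ⟨p.src, p.μ⟩ + δ ⟨p.src.shift p.μ, p.ν⟩ - δ ⟨p.src.shift p.ν, p.μ⟩ - δ ⟨p.src, p.ν⟩)) + (η : ℂ) ^ 4 * ∑ b : PBond P j, Matrix.trace (W A b * δ b)).re = 0 := by
  rw [← hgrad A δ]
  exact re_fderiv_eq_zero_of_isMinOn_segment (hSd A) hr hT hmin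

/-- **THE SAME OVER THE AFFINE-CONSTRAINT BALL OF AN ℝ-LINEAR `Q` WITHIN A REAL SUBMODULE `V`** (print's competitor space (157): `L^jηQ_jA′ = B` within the Hermitian
fields, (152)-ball): for every `δ ∈ V` with `Qδ = 0`. [cite: Balaban1985Variational, (157)-(158) p.302, (99)-(100) p.293] -/
theorem re_gradient_pairing_eq_zero_of_isMinOn_affineBall {F : Type*} [AddCommGroup F] [Module ℝ F]
    (Q : (PBond P j → Matrix (Fin 2) (Fin 2) ℂ) →ₗ[ℝ] F) (V : Submodule ℝ (PBond P j → Matrix (Fin 2) (Fin 2) ℂ))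
    (W : (PBond P j → Matrix (Fin 2) (Fin 2) ℂ) → (PBond P j → Matrix (Fin 2) (Fin 2) ℂ))
    (hSd : Differentiable ℂ (fun A : PBond P j → Matrix (Fin 2) (Fin 2) ℂ => (∑ p : Plaq P j, (1 - (2 : ℂ)⁻¹ * Matrix.trace (exp ((Complex.I * (η : ℂ)) • A ⟨p.src, p.μ⟩) * exp ((Complex.I * (η : ℂ)) • A ⟨p.src.shift p.μ, p.ν⟩) * exp (-((Complex.I * (η : ℂ)) • A ⟨p.src.shift p.ν, p.μ⟩)) * exp (-((Complex.I * (η : ℂ)) • A ⟨p.src, p.ν⟩)))))))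
    (hgrad : ∀ A δ : PBond P j → Matrix (Fin 2) (Fin 2) ℂ, fderiv ℂ (fun A : PBond P j → Matrix (Fin 2) (Fin 2) ℂ => (∑ p : Plaq P j, (1 - (2 : ℂ)⁻¹ * Matrix.trace (exp ((Complex.I * (η : ℂ)) • A ⟨p.src, p.μ⟩) * exp ((Complex.I * (η : ℂ)) • A ⟨p.src.shift p.μ, p.ν⟩) * exp (-((Complex.I * (η : ℂ)) • A ⟨p.src.shift p.ν, p.μ⟩)) * exp (-((Complex.I * (η : ℂ)) • A ⟨p.src, p.ν⟩)))))) A δ =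
      ((η : ℂ) ^ 2 / 2) * ∑ p : Plaq P j, Matrix.trace ((A ⟨p.src, p.μ⟩ + A ⟨p.src.shift p.μ, p.ν⟩ - A ⟨p.src.shift p.ν, p.μ⟩ - A ⟨p.src, p.ν⟩) * (δ ⟨p.src, p.μ⟩ + δ ⟨p.src.shift p.μ, p.ν⟩ - δ ⟨p.src.shift p.ν, p.μ⟩ - δ ⟨p.src, p.ν⟩)) + (η : ℂ) ^ 4 * ∑ b : PBond P j, Matrix.trace (W A b * δ b))
    {A : PBond P j → Matrix (Fin 2) (Fin 2) ℂ} (hA : A ∈ V) {ρ : ℝ} (hρ : 0 < ρ)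
    (hmin : IsMinOn (fun X => ((fun A : PBond P j → Matrix (Fin 2) (Fin 2) ℂ => (∑ p : Plaq P j, (1 - (2 : ℂ)⁻¹ * Matrix.trace (exp ((Complex.I * (η : ℂ)) • A ⟨p.src, p.μ⟩) * exp ((Complex.I * (η : ℂ)) • A ⟨p.src.shift p.μ, p.ν⟩) * exp (-((Complex.I * (η : ℂ)) • A ⟨p.src.shift p.ν, p.μ⟩)) * exp (-((Complex.I * (η : ℂ)) • A ⟨p.src, p.ν⟩)))))) X).re) {X | X ∈ V ∧ Q X = Q A ∧ dist X A < ρ} A)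
    {δ : PBond P j → Matrix (Fin 2) (Fin 2) ℂ} (hδV : δ ∈ V) (hδ : Q δ = 0) :
    (((η : ℂ) ^ 2 / 2) * ∑ p : Plaq P j, Matrix.trace ((A ⟨p.src, p.μ⟩ + A ⟨p.src.shift p.μ, p.ν⟩ - A ⟨p.src.shift p.ν, p.μ⟩ - A ⟨p.src, p.ν⟩) * (δ ⟨p.src, p.μ⟩ + δ ⟨p.src.shift p.μ, p.ν⟩ - δ ⟨p.src.shift p.ν, p.μ⟩ - δ ⟨p.src, p.ν⟩)) + (η : ℂ) ^ 4 * ∑ b : PBond P j, Matrix.trace (W A b * δ b)).re = 0 :=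
  re_gradient_pairing_eq_zero_of_isMinOn η W hSd hgrad (by positivity : (0 : ℝ) < ρ / (‖δ‖ + 1))
    (segment_subset_affineBall_submodule Q V A δ hA hδV hδ ρ) hmin

/-! ## §3 The hypothesis on the tree's Wilson action through the chart -/

/-- **FROM A MINIMUM OF `wilsonAction4` IN THE CHART**: if the competitor set `T` consists of bondwise self-adjoint fields, `U : T → SU(2)`-configurations realise the
chart (`↑(U X)(b) = e^{iηX(b)}` on `T`), and `A ∈ T` minimises `X ↦ wilsonAction4 (U X)` over `T ⊇` the segments through `A` in direction `δ`, then the trace pairing of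
the gradient with `δ` has zero real part (`wilsonAction4 = Re 𝒮_η` on `T`). [cite: Balaban1985Variational, (5) p.278, (157)-(158) p.302, (99) p.293] -/
theorem re_gradient_pairing_eq_zero_of_isMinOn_wilson (W : (PBond P j → Matrix (Fin 2) (Fin 2) ℂ) → (PBond P j → Matrix (Fin 2) (Fin 2) ℂ))
    (hSd : Differentiable ℂ (fun A : PBond P j → Matrix (Fin 2) (Fin 2) ℂ => (∑ p : Plaq P j, (1 - (2 : ℂ)⁻¹ * Matrix.trace (exp ((Complex.I * (η : ℂ)) • A ⟨p.src, p.μ⟩) * exp ((Complex.I * (η : ℂ)) • A ⟨p.src.shift p.μ, p.ν⟩) * exp (-((Complex.I * (η : ℂ)) • A ⟨p.src.shift p.ν, p.μ⟩)) * exp (-((Complex.I * (η : ℂ)) • A ⟨p.src, p.ν⟩)))))))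
    (hgrad : ∀ A δ : PBond P j → Matrix (Fin 2) (Fin 2) ℂ, fderiv ℂ (fun A : PBond P j → Matrix (Fin 2) (Fin 2) ℂ => (∑ p : Plaq P j, (1 - (2 : ℂ)⁻¹ * Matrix.trace (exp ((Complex.I * (η : ℂ)) • A ⟨p.src, p.μ⟩) * exp ((Complex.I * (η : ℂ)) • A ⟨p.src.shift p.μ, p.ν⟩) * exp (-((Complex.I * (η : ℂ)) • A ⟨p.src.shift p.ν, p.μ⟩)) * exp (-((Complex.I * (η : ℂ)) • A ⟨p.src, p.ν⟩)))))) A δ =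
      ((η : ℂ) ^ 2 / 2) * ∑ p : Plaq P j, Matrix.trace ((A ⟨p.src, p.μ⟩ + A ⟨p.src.shift p.μ, p.ν⟩ - A ⟨p.src.shift p.ν, p.μ⟩ - A ⟨p.src, p.ν⟩) * (δ ⟨p.src, p.μ⟩ + δ ⟨p.src.shift p.μ, p.ν⟩ - δ ⟨p.src.shift p.ν, p.μ⟩ - δ ⟨p.src, p.ν⟩)) + (η : ℂ) ^ 4 * ∑ b : PBond P j, Matrix.trace (W A b * δ b))
    {T : Set (PBond P j → Matrix (Fin 2) (Fin 2) ℂ)} (hTsa : ∀ X ∈ T, ∀ b, IsSelfAdjoint (X b))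
    (U : (PBond P j → Matrix (Fin 2) (Fin 2) ℂ) → GaugeField P j (Matrix.specialUnitaryGroup (Fin 2) ℂ))
    (hU : ∀ X ∈ T, ∀ b, ((U X b : Matrix.specialUnitaryGroup (Fin 2) ℂ) : Matrix (Fin 2) (Fin 2) ℂ) = exp ((Complex.I * (η : ℂ)) • X b))
    {A δ : PBond P j → Matrix (Fin 2) (Fin 2) ℂ} (hA : A ∈ T) {r : ℝ} (hr : 0 < r) (hT : ∀ t : ℝ, |t| < r → A + t • δ ∈ T)
    (hmin : IsMinOn (fun X => wilsonAction4 (U X)) T A) :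
    (((η : ℂ) ^ 2 / 2) * ∑ p : Plaq P j, Matrix.trace ((A ⟨p.src, p.μ⟩ + A ⟨p.src.shift p.μ, p.ν⟩ - A ⟨p.src.shift p.ν, p.μ⟩ - A ⟨p.src, p.ν⟩) * (δ ⟨p.src, p.μ⟩ + δ ⟨p.src.shift p.μ, p.ν⟩ - δ ⟨p.src.shift p.ν, p.μ⟩ - δ ⟨p.src, p.ν⟩)) + (η : ℂ) ^ 4 * ∑ b : PBond P j, Matrix.trace (W A b * δ b)).re = 0 := by
  have hmin' : IsMinOn (fun X => ((fun A : PBond P j → Matrix (Fin 2) (Fin 2) ℂ => (∑ p : Plaq P j, (1 - (2 : ℂ)⁻¹ * Matrix.trace (exp ((Complex.I * (η : ℂ)) • A ⟨p.src, p.μ⟩) * exp ((Complex.I * (η : ℂ)) • A ⟨p.src.shift p.μ, p.ν⟩) * exp (-((Complex.I * (η : ℂ)) • A ⟨p.src.shift p.ν, p.μ⟩)) * exp (-((Complex.I * (η : ℂ)) • A ⟨p.src, p.ν⟩)))))) X).re) T A := by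
    intro X hX
    have hXe := wilsonAction4_eq_re_action η X (hTsa X hX) (U X) (hU X hX)
    have hAe := wilsonAction4_eq_re_action η A (hTsa A hA) (U A) (hU A hA)
    have h := hmin hX
    simp only [Set.mem_setOf_eq] at h ⊢
    rw [← hXe, ← hAe]
    exact h
  exact re_gradient_pairing_eq_zero_of_isMinOn η W hSd hgrad hr hT hmin'

end Action

end Summit.QuantumFields.YangMills.Theorems.FlatActionCritical

end
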